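import Summits.QuantumFields.YangMills.Theorems.BalabanStepParabolic.Negative.OrbitTransport

/-!
# `BalabanStepParabolic` — negative-side support XIII: fibre slaving and the FORCED scaling limit

Support file for crux `stmt-QuantumFields-9684` (`ParabolicTrajectory.BalabanStepParabolic`), extracted from the
standing disprover's work file `Cruxes/BalabanStepParabolic/Disproof.lean` §V (cycle 3). Tree objects only; it
mechanises — and strengthens from "some subsequence" to "every admissible sequence, limit a function of the
arrival coupling" — the forced-accumulation note of `PICKED.md`.

For ANY inhabitant `S : BalabanBanachStep G r M` (any Banach space `E`, finite- or infinite-dimensional):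

* §V.1 `fibre_diff_step`, `coupling_diff_step`: one-step estimates for two chart points with couplings in
  `[0, τ]` and fibres in the `δ`-ball — the fibre difference contracts at rate `θ'` up to `C(2τ+δ)|Δg|`, the
  coupling difference cannot shrink faster than `1 − Cτ²(τ+δ)` up to the fibre feedback `Cτ³‖Δy‖`.
* §V.2 `slaving_dichotomy`, `slaving_estimate`: along two orbit segments the cone `‖Δy‖ ≤ λ|Δg|`
  (`λ = 2C(2τ+δ)/(1−θ')`) is forward invariant and outside it `‖Δy‖` contracts by `ϑ = (1+θ')/2 < 1`; hence
  `‖Δy_m‖ ≤ λ|Δg_m| + ϑ^m ‖Δy_0‖` (smallness: `Cτ²(τ+δ) + Cτ³λ ≤ (1−θ')/2`).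
* §V.3 `orbit_window`, `fibre_decay`, `exists_τ₀`, `exists_i₀`, `deep_region`: admissible Wilson orbit points
  (`0 < g ≤ τ₀`, `2c₁k ≤ 1/g² − 1/τ₀²`) have couplings in `(0, τ₀]`, fibres in the basin, and fibres in the
  `δ`-ball from depth `i₀` on.
* (in `ForcedScalingLimit.lean`) §V.4 `deep_pair_estimate`, `deep_orbit_cauchySeq`, `deep_orbit_tendsto`, `deep_limit_unique`: deep orbit
  points are `λ`-Lipschitz functions of their coupling up to `ϑ^{depth}·2δ`; deep sequences with Cauchy
  (resp. convergent) arrival couplings are Cauchy (resp. convergent in the chart), and the limit depends on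
  the arrival coupling only.
* (in `ForcedScalingLimit.lean`) §V.5 **`forced_scaling_limit`** (odd `M`): there are `g⋆ > 0` and a graph `Q : ℝ → [0,δ] × B̄_R` such that
  along EVERY admissible deep sequence with arrival couplings `→ t` the orbit points converge to `Q t` and the
  GENUINE centred Wilson `n`-point functions (`β_j = betaOf g_j → ∞`, tori `M^{k_j}(2L+1) → ∞`, `k_j`-fold
  dilated test functions, normalisations `c g_j`) CONVERGE to `expect (Q t) (2L+1) n σ f`.

Consequence for the crux: field (4c) is, for every inhabitant and every `E`, the existence of a
continuum/thermodynamic limit of dilated plaquette correlators along the inhabitant's own tuning, consistent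
across all tunings with the same arrival coupling; a refutation must exhibit non-convergence for every
admissible `(φ, Ψ, yW, betaOf, c)`, and no choice of chart can dodge the convergence requirement.
-/

namespace Summit.QuantumFields.YangMills.Theorems.BalabanStepParabolic.Negative

open scoped SchwartzMap
open MeasureTheory Filter Topology
open Literature.MathematicalPhysics.QuantumFieldTheory Literature.MathematicalPhysics.AQFT
open Literature.MathematicalPhysics.QuantumLattice

noncomputable section

variable {G : Type} [Group G] [TopologicalSpace G] [IsTopologicalGroup G] [CompactSpace G]
  [MeasurableSpace G] [BorelSpace G] {r : LatticeRep G} {M : ℕ} (S : BalabanBanachStep G r M)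

/-! ### §V.1  One-step estimates for two chart points with couplings in `[0, τ]`, fibres in the `δ`-ball -/

/-- **Fibre difference, one step**: `‖Ψ g y − Ψ g' y'‖ ≤ θ' ‖y − y'‖ + C (2τ + δ) |g − g'|`
(uniform contraction at equal coupling + Lipschitz dependence on the coupling). [folklore] -/
theorem fibre_diff_step {τ g g' : ℝ} {y y' : S.E} (hτ : τ ≤ S.δ)
    (hg : g ∈ Set.Icc 0 τ) (hg' : g' ∈ Set.Icc 0 τ) (hy : ‖y‖ ≤ S.δ) (hy' : ‖y'‖ ≤ S.δ) :
    ‖S.Ψ g y - S.Ψ g' y'‖ ≤ S.θ' * ‖y - y'‖ + S.C * (2 * τ + S.δ) * |g - g'| := by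
  have hgδ : |g| ≤ S.δ := by rw [abs_of_nonneg hg.1]; exact hg.2.trans hτ
  have hg'δ : |g'| ≤ S.δ := by rw [abs_of_nonneg hg'.1]; exact hg'.2.trans hτ
  have h1 := S.contraction g y y' hgδ (hy.trans S.δ_le_R) (hy'.trans S.δ_le_R)
  have h2 := (S.lipschitz_base g g' y' hgδ hg'δ hy').2
  have hC := S.C_pos.le
  have h3 : S.C * (|g| + |g'| + ‖y'‖) * |g - g'| ≤ S.C * (2 * τ + S.δ) * |g - g'| := by
    have : |g| + |g'| + ‖y'‖ ≤ 2 * τ + S.δ := by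
      rw [abs_of_nonneg hg.1, abs_of_nonneg hg'.1]; linarith [hg.2, hg'.2]
    gcongr
  calc ‖S.Ψ g y - S.Ψ g' y'‖ = ‖(S.Ψ g y - S.Ψ g y') + (S.Ψ g y' - S.Ψ g' y')‖ := by
        rw [sub_add_sub_cancel]
    _ ≤ ‖S.Ψ g y - S.Ψ g y'‖ + ‖S.Ψ g y' - S.Ψ g' y'‖ := norm_add_le _ _
    _ ≤ S.θ' * ‖y - y'‖ + S.C * (2 * τ + S.δ) * |g - g'| := add_le_add h1 (h2.trans h3)

/-- **Coupling difference, one step**: the coupling map separates points at least at rate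
`1 − C τ²(τ + δ)`, up to the fibre feedback `C τ³ ‖y − y'‖`:
`|φ g y − φ g' y'| ≥ (1 − C τ²(τ+δ)) |g − g'| − C τ³ ‖y − y'‖`. [folklore] -/
theorem coupling_diff_step {τ g g' : ℝ} {y y' : S.E} (hτ : τ ≤ S.δ)
    (hg : g ∈ Set.Icc 0 τ) (hg' : g' ∈ Set.Icc 0 τ) (hy : ‖y‖ ≤ S.δ) (hy' : ‖y'‖ ≤ S.δ) :
    (1 - S.C * τ ^ 2 * (τ + S.δ)) * |g - g'| - S.C * τ ^ 3 * ‖y - y'‖ ≤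
      |S.φ g y - S.φ g' y'| := by
  have hτ0 : 0 ≤ τ := hg.1.trans hg.2
  have hgδ : |g| ≤ S.δ := by rw [abs_of_nonneg hg.1]; exact hg.2.trans hτ
  have hg'δ : |g'| ≤ S.δ := by rw [abs_of_nonneg hg'.1]; exact hg'.2.trans hτ
  have hC := S.C_pos.le
  have hb := S.b_pos.le
  -- fibre feedback at fixed coupling `g`
  have h1 : |S.φ g y - S.φ g y'| ≤ S.C * τ ^ 3 * ‖y - y'‖ := by
    have h := (S.lipschitz_fibre g y y' hgδ hy hy').1
    have h3 : |g| ^ 3 ≤ τ ^ 3 := by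
      rw [abs_of_nonneg hg.1]; exact pow_le_pow_left₀ hg.1 hg.2 3
    calc |S.φ g y - S.φ g y'| ≤ S.C * |g| ^ 3 * ‖y - y'‖ := h
      _ ≤ S.C * τ ^ 3 * ‖y - y'‖ := by gcongr
  -- base Lipschitz at fixed fibre `y'`
  have h2 := (S.lipschitz_base g g' y' hgδ hg'δ hy').1
  set m := max |g| |g'| with hm
  have hmτ : m ≤ τ := by
    rw [hm, abs_of_nonneg hg.1, abs_of_nonneg hg'.1]; exact max_le hg.2 hg'.2
  have hm0 : 0 ≤ m := le_trans (abs_nonneg g) (le_max_left _ _)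
  have h3 : S.C * m ^ 2 * (m + ‖y'‖) * |g - g'| ≤ S.C * τ ^ 2 * (τ + S.δ) * |g - g'| := by
    gcongr
  -- the linear part expands: |(g - g') + b (g³ - g'³)| = |g - g'| (1 + b (g² + g g' + g'²)) ≥ |g - g'|
  have h4 : |g - g'| ≤ |(g - g') + S.b * (g ^ 3 - g' ^ 3)| := by
    have hfac : (g - g') + S.b * (g ^ 3 - g' ^ 3) = (g - g') * (1 + S.b * (g ^ 2 + g * g' + g' ^ 2)) := by
      ring
    have hq : 0 ≤ S.b * (g ^ 2 + g * g' + g' ^ 2) := by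
      have : 0 ≤ g ^ 2 + g * g' + g' ^ 2 := by nlinarith [hg.1, hg'.1]
      positivity
    rw [hfac, abs_mul, abs_of_nonneg (by linarith : (0 : ℝ) ≤ 1 + S.b * (g ^ 2 + g * g' + g' ^ 2))]
    nlinarith [abs_nonneg (g - g')]
  -- combine: |φ g y' - φ g' y'| ≥ |lin| - C m²(m+‖y'‖)|g-g'|
  have h5 : |(g - g') + S.b * (g ^ 3 - g' ^ 3)| - S.C * m ^ 2 * (m + ‖y'‖) * |g - g'| ≤
      |S.φ g y' - S.φ g' y'| := by
    have := abs_sub_abs_le_abs_sub ((g - g') + S.b * (g ^ 3 - g' ^ 3)) (S.φ g y' - S.φ g' y')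
    have e : (g - g') + S.b * (g ^ 3 - g' ^ 3) - (S.φ g y' - S.φ g' y') =
        -(S.φ g y' - S.φ g' y' - (g - g') - S.b * (g ^ 3 - g' ^ 3)) := by ring
    rw [e, abs_neg] at this
    linarith
  have h6 : |S.φ g y' - S.φ g' y'| - |S.φ g y - S.φ g y'| ≤ |S.φ g y - S.φ g' y'| := by
    have := abs_sub_abs_le_abs_sub (S.φ g y' - S.φ g' y') (S.φ g y' - S.φ g y)
    have e : S.φ g y' - S.φ g' y' - (S.φ g y' - S.φ g y) = S.φ g y - S.φ g' y' := by ring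
    rw [e, abs_sub_comm (S.φ g y') (S.φ g y)] at this
    linarith
  nlinarith [h1, h3, h4, h5, h6, abs_nonneg (g - g')]

/-! ### §V.2  The cone dichotomy along two orbit segments -/

/-- **Slaving dichotomy.** Let two orbit segments of length `m` have couplings in `[0, τ]` and
fibres in the `δ`-ball at every time `i < m`, where `τ ≤ δ` satisfies the smallness condition
`C τ²(τ + δ) + C τ³ λ ≤ (1 − θ')/2` with `λ = 2C(2τ+δ)/(1−θ')`. Then at time `m` EITHER the fibre
difference is slaved to the coupling difference, `‖Δy_m‖ ≤ λ |Δg_m|`, OR it has contracted all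
along, `‖Δy_m‖ ≤ ϑ^m ‖Δy_0‖` with `ϑ = (1 + θ')/2 < 1` (the cone `‖Δy‖ ≤ λ|Δg|` is forward
invariant, and outside it the fibre difference contracts by `ϑ`). [folklore] -/
theorem slaving_dichotomy {τ : ℝ} (hτ : τ ≤ S.δ)
    (hsmall : S.C * τ ^ 2 * (τ + S.δ) + S.C * τ ^ 3 * (2 * S.C * (2 * τ + S.δ) / (1 - S.θ')) ≤
      (1 - S.θ') / 2)
    (p q : ℝ × S.E) (m : ℕ)
    (hp : ∀ i < m, (S.F^[i] p).1 ∈ Set.Icc 0 τ ∧ ‖(S.F^[i] p).2‖ ≤ S.δ)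
    (hq : ∀ i < m, (S.F^[i] q).1 ∈ Set.Icc 0 τ ∧ ‖(S.F^[i] q).2‖ ≤ S.δ) :
    ‖(S.F^[m] p).2 - (S.F^[m] q).2‖ ≤
        (2 * S.C * (2 * τ + S.δ) / (1 - S.θ')) * |(S.F^[m] p).1 - (S.F^[m] q).1| ∨
      ‖(S.F^[m] p).2 - (S.F^[m] q).2‖ ≤ ((1 + S.θ') / 2) ^ m * ‖p.2 - q.2‖ := by
  set lam := 2 * S.C * (2 * τ + S.δ) / (1 - S.θ') with hlam
  set ϑ := (1 + S.θ') / 2 with hϑ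
  have hθ'0 := S.θ'_nonneg
  have hθ'1 : 0 < 1 - S.θ' := by linarith [S.θ'_lt_one]
  have hC := S.C_pos.le
  have hδ := S.δ_pos
  have hΛ : S.C * (2 * τ + S.δ) = (1 - S.θ') / 2 * lam := by
    rw [hlam]; field_simp
  induction m with
  | zero => right; simp
  | succ m ih =>
    have hp' : ∀ i < m, (S.F^[i] p).1 ∈ Set.Icc 0 τ ∧ ‖(S.F^[i] p).2‖ ≤ S.δ :=
      fun i hi => hp i (Nat.lt_succ_of_lt hi)
    have hq' : ∀ i < m, (S.F^[i] q).1 ∈ Set.Icc 0 τ ∧ ‖(S.F^[i] q).2‖ ≤ S.δ :=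
      fun i hi => hq i (Nat.lt_succ_of_lt hi)
    obtain ⟨hpm1, hpm2⟩ := hp m (Nat.lt_succ_self m)
    obtain ⟨hqm1, hqm2⟩ := hq m (Nat.lt_succ_self m)
    have hτ0 : 0 ≤ τ := hpm1.1.trans hpm1.2
    have hlam0 : 0 ≤ lam := by
      rw [hlam]; apply div_nonneg (by nlinarith) hθ'1.le
    set u := S.F^[m] p with hu
    set v := S.F^[m] q with hv
    have hsu : S.F^[m + 1] p = (S.φ u.1 u.2, S.Ψ u.1 u.2) := by
      rw [Function.iterate_succ_apply', ← hu]; rfl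
    have hsv : S.F^[m + 1] q = (S.φ v.1 v.2, S.Ψ v.1 v.2) := by
      rw [Function.iterate_succ_apply', ← hv]; rfl
    rw [hsu, hsv]
    simp only
    -- one-step estimates
    have hfib := fibre_diff_step S hτ hpm1 hqm1 hpm2 hqm2
    have hcpl := coupling_diff_step S hτ hpm1 hqm1 hpm2 hqm2
    set D := |u.1 - v.1| with hD
    set e := ‖u.2 - v.2‖ with he
    set D' := |S.φ u.1 u.2 - S.φ v.1 v.2| with hD'
    set e' := ‖S.Ψ u.1 u.2 - S.Ψ v.1 v.2‖ with he'
    have hD0 : 0 ≤ D := abs_nonneg _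
    have he0 : 0 ≤ e := norm_nonneg _
    rw [hΛ] at hfib
    rcases ih hp' hq' with hcone | hcontr
    · -- inside the cone: stays inside
      left
      -- e' ≤ θ' lam D + (1-θ')/2 lam D = ϑ lam D
      have h1 : e' ≤ ϑ * (lam * D) := by
        have : S.θ' * e ≤ S.θ' * (lam * D) := mul_le_mul_of_nonneg_left hcone hθ'0
        rw [hϑ]; nlinarith
      -- D' ≥ (1 - Cτ²(τ+δ)) D - C τ³ e ≥ (1 - Cτ²(τ+δ) - Cτ³ lam) D ≥ ϑ D
      have h2 : ϑ * D ≤ D' := by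
        have h3 : S.C * τ ^ 3 * e ≤ S.C * τ ^ 3 * (lam * D) :=
          mul_le_mul_of_nonneg_left hcone (by positivity)
        rw [hϑ]
        nlinarith
      calc e' ≤ ϑ * (lam * D) := h1
        _ = lam * (ϑ * D) := by ring
        _ ≤ lam * D' := mul_le_mul_of_nonneg_left h2 hlam0
    · -- contracted so far: either enters the cone now, or contracts once more
      by_cases hcone : e ≤ lam * D
      · left
        have h1 : e' ≤ ϑ * (lam * D) := by
          have : S.θ' * e ≤ S.θ' * (lam * D) := mul_le_mul_of_nonneg_left hcone hθ'0
          rw [hϑ]; nlinarith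
        have h2 : ϑ * D ≤ D' := by
          have h3 : S.C * τ ^ 3 * e ≤ S.C * τ ^ 3 * (lam * D) :=
            mul_le_mul_of_nonneg_left hcone (by positivity)
          rw [hϑ]
          nlinarith
        calc e' ≤ ϑ * (lam * D) := h1
          _ = lam * (ϑ * D) := by ring
          _ ≤ lam * D' := mul_le_mul_of_nonneg_left h2 hlam0
      · right
        push Not at hcone
        -- outside the cone: (1-θ')/2 lam D ≤ (1-θ')/2 e, so e' ≤ ϑ e
        have h1 : e' ≤ ϑ * e := by
          have : (1 - S.θ') / 2 * lam * D ≤ (1 - S.θ') / 2 * e := by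
            rw [mul_assoc]; exact mul_le_mul_of_nonneg_left hcone.le (by positivity)
          rw [hϑ]; nlinarith
        calc e' ≤ ϑ * e := h1
          _ ≤ ϑ * (ϑ ^ m * ‖p.2 - q.2‖) := mul_le_mul_of_nonneg_left hcontr (by positivity)
          _ = ϑ ^ (m + 1) * ‖p.2 - q.2‖ := by ring

/-- **Slaving estimate (sum form).** Under the hypotheses of `slaving_dichotomy`:
`‖Δy_m‖ ≤ λ |Δg_m| + ϑ^m ‖Δy_0‖`. [folklore] -/
theorem slaving_estimate {τ : ℝ} (hτ0 : 0 ≤ τ) (hτ : τ ≤ S.δ)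
    (hsmall : S.C * τ ^ 2 * (τ + S.δ) + S.C * τ ^ 3 * (2 * S.C * (2 * τ + S.δ) / (1 - S.θ')) ≤
      (1 - S.θ') / 2)
    (p q : ℝ × S.E) (m : ℕ)
    (hp : ∀ i < m, (S.F^[i] p).1 ∈ Set.Icc 0 τ ∧ ‖(S.F^[i] p).2‖ ≤ S.δ)
    (hq : ∀ i < m, (S.F^[i] q).1 ∈ Set.Icc 0 τ ∧ ‖(S.F^[i] q).2‖ ≤ S.δ) :
    ‖(S.F^[m] p).2 - (S.F^[m] q).2‖ ≤
      (2 * S.C * (2 * τ + S.δ) / (1 - S.θ')) * |(S.F^[m] p).1 - (S.F^[m] q).1| +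
        ((1 + S.θ') / 2) ^ m * ‖p.2 - q.2‖ := by
  have hθ'0 := S.θ'_nonneg
  have hθ'1 : 0 < 1 - S.θ' := by linarith [S.θ'_lt_one]
  have hC := S.C_pos.le
  have hδ := S.δ_pos.le
  have hA : 0 ≤ (2 * S.C * (2 * τ + S.δ) / (1 - S.θ')) * |(S.F^[m] p).1 - (S.F^[m] q).1| := by
    positivity
  have hB : 0 ≤ ((1 + S.θ') / 2) ^ m * ‖p.2 - q.2‖ := by positivity
  rcases slaving_dichotomy S hτ hsmall p q m hp hq with h | h
  · exact h.trans (le_add_of_nonneg_right hB)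
  · exact h.trans (le_add_of_nonneg_left hA)


/-! ### §V.3  Deep Wilson orbits: window, fibre decay, thresholds -/

/-- **Orbit window with a cap `τ ≤ gₛ`.** For `0 < g ≤ τ ≤ gₛ`, `g ≤ g₀` and
`2 c₁ k ≤ 1/g² − 1/τ²`, the Wilson orbit from `g` has couplings in `(0, τ]` and fibres in the basin
for all `j ≤ k`. [folklore] -/
theorem orbit_window {τ g : ℝ} (hτs : τ ≤ (min S.δ (min (Real.sqrt (1 / (2 * (S.b + S.C * (S.δ + S.R))))) (Real.sqrt ((1 - S.θ') * S.R / S.C))))) (hg0 : 0 < g) (hgτ : g ≤ τ) (hg₀ : g ≤ S.g₀) (k : ℕ)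
    (hk : 2 * (S.b + S.C * (S.δ + S.R)) * k ≤ 1 / g ^ 2 - 1 / τ ^ 2) :
    ∀ j ≤ k, 0 < (S.F^[j] (g, S.yW g)).1 ∧ (S.F^[j] (g, S.yW g)).1 ≤ τ ∧
      ‖(S.F^[j] (g, S.yW g)).2‖ ≤ S.R := by
  intro j hj
  have hτ0 : 0 < τ := hg0.trans_le hgτ
  have hgs0 := gₛ_pos S
  have hk' : 2 * (S.b + S.C * (S.δ + S.R)) * k ≤ 1 / g ^ 2 - 1 / (min S.δ (min (Real.sqrt (1 / (2 * (S.b + S.C * (S.δ + S.R))))) (Real.sqrt ((1 - S.θ') * S.R / S.C)))) ^ 2 := by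
    have : 1 / (min S.δ (min (Real.sqrt (1 / (2 * (S.b + S.C * (S.δ + S.R))))) (Real.sqrt ((1 - S.θ') * S.R / S.C)))) ^ 2 ≤ 1 / τ ^ 2 := by
      apply one_div_le_one_div_of_le (by positivity)
      exact pow_le_pow_left₀ hτ0.le hτs 2
    linarith
  obtain ⟨hpos, -, hy, hinv⟩ := orbit_mem_chart S hg0 (hgτ.trans hτs) hg₀ k hk' j hj
  refine ⟨hpos, ?_, hy⟩
  have hc₁ := c₁_pos S
  have hjk : (2 * (S.b + S.C * (S.δ + S.R)) * j : ℝ) ≤ 2 * (S.b + S.C * (S.δ + S.R)) * k := by gcongr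
  have h1 : 1 / τ ^ 2 ≤ 1 / (S.F^[j] (g, S.yW g)).1 ^ 2 := by linarith
  rw [div_le_div_iff₀ (by positivity) (by positivity), one_mul, one_mul] at h1
  nlinarith

/-- **Fibre decay along an orbit**: if the first `j` points of an orbit have couplings in `[0, τ]`
(`τ ≤ δ`) and fibres in the basin, then `‖y_j‖ ≤ θ'^j ‖y_0‖ + C τ²/(1 − θ')`. [folklore] -/
theorem fibre_decay {τ : ℝ} (hτ : τ ≤ S.δ) (p : ℝ × S.E) (j : ℕ)
    (hp : ∀ i < j, (S.F^[i] p).1 ∈ Set.Icc 0 τ ∧ ‖(S.F^[i] p).2‖ ≤ S.R) :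
    ‖(S.F^[j] p).2‖ ≤ S.θ' ^ j * ‖p.2‖ + S.C * τ ^ 2 / (1 - S.θ') := by
  have hθ'0 := S.θ'_nonneg
  have hθ'1 : 0 < 1 - S.θ' := by linarith [S.θ'_lt_one]
  have hC := S.C_pos.le
  induction j with
  | zero =>
    simp only [Function.iterate_zero, id_eq, pow_zero, one_mul, le_add_iff_nonneg_right]
    positivity
  | succ j ih =>
    have hp' : ∀ i < j, (S.F^[i] p).1 ∈ Set.Icc 0 τ ∧ ‖(S.F^[i] p).2‖ ≤ S.R :=
      fun i hi => hp i (Nat.lt_succ_of_lt hi)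
    obtain ⟨hj1, hj2⟩ := hp j (Nat.lt_succ_self j)
    have ih' := ih hp'
    set u := S.F^[j] p with hu
    have hsu : S.F^[j + 1] p = (S.φ u.1 u.2, S.Ψ u.1 u.2) := by
      rw [Function.iterate_succ_apply', ← hu]; rfl
    rw [hsu]
    have habs : |u.1| ≤ S.δ := by rw [abs_of_nonneg hj1.1]; exact hj1.2.trans hτ
    have h1 := S.norm_Ψ_le habs hj2
    have h2 : S.C * u.1 ^ 2 ≤ S.C * τ ^ 2 := by
      gcongr; exacts [hj1.1, hj1.2]
    have key : S.θ' * (S.C * τ ^ 2 / (1 - S.θ')) + S.C * τ ^ 2 = S.C * τ ^ 2 / (1 - S.θ') := by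
      field_simp; ring
    calc ‖S.Ψ u.1 u.2‖ ≤ S.θ' * ‖u.2‖ + S.C * u.1 ^ 2 := h1
      _ ≤ S.θ' * (S.θ' ^ j * ‖p.2‖ + S.C * τ ^ 2 / (1 - S.θ')) + S.C * τ ^ 2 := by
          gcongr
      _ = S.θ' ^ (j + 1) * ‖p.2‖ + (S.θ' * (S.C * τ ^ 2 / (1 - S.θ')) + S.C * τ ^ 2) := by ring
      _ = S.θ' ^ (j + 1) * ‖p.2‖ + S.C * τ ^ 2 / (1 - S.θ') := by rw [key]

/-- **The coupling threshold.** There is `τ₀ ∈ (0, min gₛ g₀]` with `C τ₀²/(1−θ') ≤ δ/2` and the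
smallness condition of `slaving_dichotomy`. [folklore] -/
theorem exists_τ₀ : ∃ τ₀ : ℝ, 0 < τ₀ ∧ τ₀ ≤ (min S.δ (min (Real.sqrt (1 / (2 * (S.b + S.C * (S.δ + S.R))))) (Real.sqrt ((1 - S.θ') * S.R / S.C)))) ∧ τ₀ ≤ S.g₀ ∧
    S.C * τ₀ ^ 2 / (1 - S.θ') ≤ S.δ / 2 ∧
    S.C * τ₀ ^ 2 * (τ₀ + S.δ) + S.C * τ₀ ^ 3 * (2 * S.C * (2 * τ₀ + S.δ) / (1 - S.θ')) ≤
      (1 - S.θ') / 2 := by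
  have hθ'1 : 0 < 1 - S.θ' := by linarith [S.θ'_lt_one]
  have hδ := S.δ_pos
  have hcont1 : Continuous fun τ : ℝ => S.C * τ ^ 2 / (1 - S.θ') := by fun_prop
  have hcont2 : Continuous fun τ : ℝ =>
      S.C * τ ^ 2 * (τ + S.δ) + S.C * τ ^ 3 * (2 * S.C * (2 * τ + S.δ) / (1 - S.θ')) := by
    fun_prop
  have hev1 : ∀ᶠ τ in 𝓝 (0 : ℝ), S.C * τ ^ 2 / (1 - S.θ') < S.δ / 2 := by
    refine hcont1.continuousAt.eventually_lt continuousAt_const ?_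
    simp only [ne_eq, OfNat.ofNat_ne_zero, not_false_eq_true, zero_pow, mul_zero, zero_div]
    positivity
  have hev2 : ∀ᶠ τ in 𝓝 (0 : ℝ),
      S.C * τ ^ 2 * (τ + S.δ) + S.C * τ ^ 3 * (2 * S.C * (2 * τ + S.δ) / (1 - S.θ')) <
        (1 - S.θ') / 2 := by
    refine hcont2.continuousAt.eventually_lt continuousAt_const ?_
    simp only [ne_eq, OfNat.ofNat_ne_zero, not_false_eq_true, zero_pow, mul_zero, zero_mul,
      add_zero]
    positivity
  have hev3 : ∀ᶠ τ in 𝓝[>] (0 : ℝ), τ ∈ Set.Ioo 0 (min (min S.δ (min (Real.sqrt (1 / (2 * (S.b + S.C * (S.δ + S.R))))) (Real.sqrt ((1 - S.θ') * S.R / S.C)))) S.g₀) :=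
    Ioo_mem_nhdsGT (lt_min (gₛ_pos S) S.g₀_pos)
  obtain ⟨τ₀, ⟨h1, h2⟩, h3⟩ :=
    (((hev1.and hev2).filter_mono nhdsWithin_le_nhds).and hev3).exists
  exact ⟨τ₀, h3.1, (h3.2.le.trans (min_le_left _ _)), (h3.2.le.trans (min_le_right _ _)),
    h1.le, h2.le⟩

/-- **The depth threshold**: `θ'^i₀ R ≤ δ/2` for some `i₀`. [folklore] -/
theorem exists_i₀ : ∃ i₀ : ℕ, S.θ' ^ i₀ * S.R ≤ S.δ / 2 := by
  have h := (tendsto_pow_atTop_nhds_zero_of_lt_one S.θ'_nonneg S.θ'_lt_one).mul_const S.R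
  rw [zero_mul] at h
  have hev := h.eventually (eventually_le_nhds (half_pos S.δ_pos))
  exact hev.exists

/-- **Deep orbit points are in the slaving region.** With `τ₀`, `i₀` as above, an admissible
Wilson orbit point (`0 < g ≤ τ₀`, `2 c₁ k ≤ 1/g² − 1/τ₀²`) has, at every depth `j ∈ [i₀, k]`,
coupling in `[0, τ₀]` and fibre in the `δ`-ball; at every depth `j ≤ k` it is in the chart. [folklore] -/
theorem deep_region {τ₀ : ℝ} (hτs : τ₀ ≤ (min S.δ (min (Real.sqrt (1 / (2 * (S.b + S.C * (S.δ + S.R))))) (Real.sqrt ((1 - S.θ') * S.R / S.C))))) (hτg₀ : τ₀ ≤ S.g₀)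
    (hτδ2 : S.C * τ₀ ^ 2 / (1 - S.θ') ≤ S.δ / 2) {i₀ : ℕ} (hi₀ : S.θ' ^ i₀ * S.R ≤ S.δ / 2)
    {g : ℝ} (hg0 : 0 < g) (hgτ : g ≤ τ₀) (k : ℕ) (hk : 2 * (S.b + S.C * (S.δ + S.R)) * k ≤ 1 / g ^ 2 - 1 / τ₀ ^ 2) :
    (∀ j ≤ k, (S.F^[j] (g, S.yW g)).1 ∈ Set.Icc 0 τ₀ ∧ ‖(S.F^[j] (g, S.yW g)).2‖ ≤ S.R) ∧
    (∀ j ≤ k, i₀ ≤ j → ‖(S.F^[j] (g, S.yW g)).2‖ ≤ S.δ) := by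
  have hτδ : τ₀ ≤ S.δ := hτs.trans (gₛ_le_δ S)
  have hw := orbit_window S hτs hg0 hgτ (hgτ.trans hτg₀) k hk
  have hA : ∀ j ≤ k, (S.F^[j] (g, S.yW g)).1 ∈ Set.Icc 0 τ₀ ∧ ‖(S.F^[j] (g, S.yW g)).2‖ ≤ S.R :=
    fun j hj => ⟨⟨(hw j hj).1.le, (hw j hj).2.1⟩, (hw j hj).2.2⟩
  refine ⟨hA, fun j hj hij => ?_⟩
  have hdec := fibre_decay S hτδ (g, S.yW g) j (fun i hi => hA i (hi.le.trans hj))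
  have hθ'0 := S.θ'_nonneg
  have hθ'1 := S.θ'_lt_one
  have hR := S.R_pos
  have hyW : ‖S.yW g‖ ≤ S.R := S.norm_yW_le g ⟨hg0.le, hgτ.trans hτg₀⟩
  have hpow : S.θ' ^ j ≤ S.θ' ^ i₀ := pow_le_pow_of_le_one hθ'0 hθ'1.le hij
  calc ‖(S.F^[j] (g, S.yW g)).2‖ ≤ S.θ' ^ j * ‖S.yW g‖ + S.C * τ₀ ^ 2 / (1 - S.θ') := hdec
    _ ≤ S.θ' ^ i₀ * S.R + S.δ / 2 := by gcongr
    _ ≤ S.δ / 2 + S.δ / 2 := by gcongr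
    _ = S.δ := by ring

end

end Summit.QuantumFields.YangMills.Theorems.BalabanStepParabolic.Negative
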